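import Summits.HubbardSuperconductivity.HubbardSuperconductivity.Theorems.NodalWardXYDefs
import Literature.Probability.LatticeModels.SpinWaveComplexStabilityTorus

/-!
# `PerturbedXYOrder` (stmt-HubbardSuperconductivity-10739) — line `schwarz-inheritance`, stub `stub_e3Kernel`

The block kernel of the exponent-`3` tightness example. For `y : Fin 3 → Fin (2^n)` write
`ι y = fun k => ((y k : ℕ) : ZMod L)`, `Q_n = Fin 3 → Fin (2^n)`,
`count_n(x,x') = #{(y,y') ∈ Q_n × Q_n : x' + ι y = x + ι y'}` (the `Finset.univ.filter … .card` below) and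
`κ(x,x') = ε c Σ_{n<N} count_n(x,x') / 2^(6n)` (real). We prove:

* `count_n(x,x') ≤ 2^(3n)` for `2ⁿ ≤ L` (`ι` is injective on `Q_n`, so a witness pair is determined by its second
  component), and `count_n(x,x') = 0` unless `dist(x,x') + 6 ≤ 6·2ⁿ` (a witness `(y,y')` yields a walk of
  `Σ_k y'_k + Σ_k y_k ≤ 6(2ⁿ − 1)` unit steps from `x` to `x'`);
* hence, for `2^N ≤ L`, `Σ_{n<N} count_n/2^(6n) ≤ Σ_{n ≥ n₀} 8^(-n) ≤ (8/7)·216/(d+6)³`, `n₀` the least contributing `n`,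
  so `κ ≤ ε/(1+d)³` as soon as `c ≤ 7/1728`, in particular for `c ≤ 1/512`: `κ` is admissible with exponent THREE;
* `κ ≥ 0`;
* `W_κ(θ) = ε c Σ_{n<N} S_n(θ)` exactly, where `S_n(θ) = Σ_z ((Σ_{y ∈ Q_n} j_θ(z + ι y))/2^(3n))²` and
  `j_θ(z) = Σ_i cur (z,i) θ` (expand the square, substitute `x = z + ι y`, and count).

No definitions; all block expressions are written inline, as in the registered signature.
-/

noncomputable section

namespace Summit.HubbardSuperconductivity.HubbardSuperconductivity.Theorems.PerturbedXYOrder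

open MeasureTheory Literature.Probability.LatticeModels
open Summit.HubbardSuperconductivity.HubbardSuperconductivity.Theses.NodalWardXY

/-! ### Walks of unit steps on the torus -/

/-- One unit step on the torus: `dist(z, z + e_k) ≤ 1` (the two sites are equal or adjacent). -/
theorem ker_dist_add_single_le {L : ℕ} (z : TorusSite 3 L) (k : Fin 3) :
    (torusGraph 3 L).dist z (z + Pi.single k 1) ≤ 1 := by
  by_cases h : z = z + Pi.single k 1
  · rw [← h, SimpleGraph.dist_self]
    exact Nat.zero_le _
  · exact (SimpleGraph.dist_eq_one_iff_adj.2 ((torusGraph_adj_iff _ _).2 ⟨h, Or.inl ⟨k, rfl⟩⟩)).le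

/-- `m` unit steps in direction `k`: `dist(z, z + m e_k) ≤ m`. -/
theorem ker_dist_add_single_natCast_le {L : ℕ} [NeZero L] (z : TorusSite 3 L) (k : Fin 3) (m : ℕ) :
    (torusGraph 3 L).dist z (z + Pi.single k ((m : ℕ) : ZMod L)) ≤ m := by
  induction m with
  | zero => simp
  | succ m ih =>
      have e1 : (z + Pi.single k (((m + 1 : ℕ)) : ZMod L) : TorusSite 3 L) =
          z + Pi.single k ((m : ℕ) : ZMod L) + Pi.single k 1 := by
        rw [Nat.cast_succ, Pi.single_add, ← add_assoc]
      have t := (torusGraph_reachable z (z + Pi.single k ((m : ℕ) : ZMod L))).dist_triangle_left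
        (z + Pi.single k ((m : ℕ) : ZMod L) + Pi.single k 1)
      have s := ker_dist_add_single_le (z + Pi.single k ((m : ℕ) : ZMod L)) k
      rw [e1]
      omega

/-- A walk of `Σ_k y_k` unit steps: `dist(z, z + ι y) ≤ y 0 + y 1 + y 2` for `y : Fin 3 → ℕ`. -/
theorem ker_dist_add_natCast_le {L : ℕ} [NeZero L] (z : TorusSite 3 L) (y : Fin 3 → ℕ) :
    (torusGraph 3 L).dist z (z + fun k => ((y k : ℕ) : ZMod L)) ≤ y 0 + y 1 + y 2 := by
  have hdec : ((fun k => ((y k : ℕ) : ZMod L)) : TorusSite 3 L) =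
      Pi.single 0 ((y 0 : ℕ) : ZMod L) + Pi.single 1 ((y 1 : ℕ) : ZMod L) +
        Pi.single 2 ((y 2 : ℕ) : ZMod L) := by
    funext k
    fin_cases k <;> simp
  rw [hdec, ← add_assoc, ← add_assoc]
  have h0 := ker_dist_add_single_natCast_le z 0 (y 0)
  have h1 := ker_dist_add_single_natCast_le (z + Pi.single 0 ((y 0 : ℕ) : ZMod L)) 1 (y 1)
  have h2 := ker_dist_add_single_natCast_le
    (z + Pi.single 0 ((y 0 : ℕ) : ZMod L) + Pi.single 1 ((y 1 : ℕ) : ZMod L)) 2 (y 2)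
  have t1 := (torusGraph_reachable z (z + Pi.single 0 ((y 0 : ℕ) : ZMod L))).dist_triangle_left
    (z + Pi.single 0 ((y 0 : ℕ) : ZMod L) + Pi.single 1 ((y 1 : ℕ) : ZMod L))
  have t2 := (torusGraph_reachable z
    (z + Pi.single 0 ((y 0 : ℕ) : ZMod L) + Pi.single 1 ((y 1 : ℕ) : ZMod L))).dist_triangle_left
    (z + Pi.single 0 ((y 0 : ℕ) : ZMod L) + Pi.single 1 ((y 1 : ℕ) : ZMod L) + Pi.single 2 ((y 2 : ℕ) : ZMod L))
  omega

/-! ### The counting function `count_n(x,x') = #{(y,y') ∈ Q_n² : x' + ι y = x + ι y'}` -/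

/-- **Range of the block kernel.** A witness `(y, y') ∈ Q_n²` of `x' + ι y = x + ι y'` gives a walk of at most
`Σ_k y'_k + Σ_k y_k ≤ 6(2ⁿ − 1)` unit steps from `x` to `x'`; so `count_n(x,x') ≠ 0` forces `dist(x,x') + 6 ≤ 6·2ⁿ`. -/
theorem ker_dist_le_of_card_ne_zero {L : ℕ} [NeZero L] (n : ℕ) (x x' : TorusSite 3 L)
    (h : (Finset.univ.filter (fun p : (Fin 3 → Fin (2 ^ n)) × (Fin 3 → Fin (2 ^ n)) =>
      x' + (fun k => ((p.1 k : ℕ) : ZMod L)) = x + (fun k => ((p.2 k : ℕ) : ZMod L)))).card ≠ 0) :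
    (torusGraph 3 L).dist x x' + 6 ≤ 6 * 2 ^ n := by
  obtain ⟨p, hp⟩ := Finset.card_ne_zero.1 h
  have hp' : x' + (fun k => ((p.1 k : ℕ) : ZMod L)) = x + (fun k => ((p.2 k : ℕ) : ZMod L)) :=
    (Finset.mem_filter.1 hp).2
  have h1 := ker_dist_add_natCast_le x (fun k => (p.2 k : ℕ))
  have h2 := ker_dist_add_natCast_le x' (fun k => (p.1 k : ℕ))
  rw [hp', SimpleGraph.dist_comm] at h2
  have htri := (torusGraph_reachable x (x + fun k => ((p.2 k : ℕ) : ZMod L))).dist_triangle_left x'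
  have b0 := (p.1 0).isLt
  have b1 := (p.1 1).isLt
  have b2 := (p.1 2).isLt
  have c0 := (p.2 0).isLt
  have c1 := (p.2 1).isLt
  have c2 := (p.2 2).isLt
  omega

/-- **Size of the block kernel.** For `2ⁿ ≤ L` the map `ι : Q_n → (ℤ/Lℤ)³` is injective, so a witness pair
`(y, y')` of `x' + ι y = x + ι y'` is determined by `y'`, and `count_n(x,x') ≤ #Q_n = 2^(3n)`. -/
theorem ker_card_le {L : ℕ} (n : ℕ) (hn : 2 ^ n ≤ L) (x x' : TorusSite 3 L) :
    (Finset.univ.filter (fun p : (Fin 3 → Fin (2 ^ n)) × (Fin 3 → Fin (2 ^ n)) =>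
      x' + (fun k => ((p.1 k : ℕ) : ZMod L)) = x + (fun k => ((p.2 k : ℕ) : ZMod L)))).card ≤ 2 ^ (3 * n) := by
  have hinj : ∀ y y' : Fin 3 → Fin (2 ^ n),
      ((fun k => ((y k : ℕ) : ZMod L)) : TorusSite 3 L) = (fun k => ((y' k : ℕ) : ZMod L)) → y = y' := by
    intro y y' hyy
    funext k
    have hk : ((y k : ℕ) : ZMod L) = ((y' k : ℕ) : ZMod L) := congr_fun hyy k
    have hv := congr_arg ZMod.val hk
    rw [ZMod.val_cast_of_lt ((y k).isLt.trans_le hn), ZMod.val_cast_of_lt ((y' k).isLt.trans_le hn)] at hv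
    exact Fin.ext hv
  calc (Finset.univ.filter (fun p : (Fin 3 → Fin (2 ^ n)) × (Fin 3 → Fin (2 ^ n)) =>
        x' + (fun k => ((p.1 k : ℕ) : ZMod L)) = x + (fun k => ((p.2 k : ℕ) : ZMod L)))).card
      ≤ (Finset.univ : Finset (Fin 3 → Fin (2 ^ n))).card := by
        refine Finset.card_le_card_of_injOn (fun p => p.2) (fun p _ => Finset.mem_univ _) ?_
        intro p hp q hq hpq
        have hp' : x' + (fun k => ((p.1 k : ℕ) : ZMod L)) = x + (fun k => ((p.2 k : ℕ) : ZMod L)) :=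
          (Finset.mem_filter.1 (Finset.mem_coe.1 hp)).2
        have hq' : x' + (fun k => ((q.1 k : ℕ) : ZMod L)) = x + (fun k => ((q.2 k : ℕ) : ZMod L)) :=
          (Finset.mem_filter.1 (Finset.mem_coe.1 hq)).2
        have hpq' : p.2 = q.2 := hpq
        have hmid : x + (fun k => ((p.2 k : ℕ) : ZMod L)) = x + (fun k => ((q.2 k : ℕ) : ZMod L)) := by
          rw [hpq']
        exact Prod.ext (hinj _ _ (add_left_cancel (hp'.trans (hmid.trans hq'.symm)))) hpq'
    _ = 2 ^ (3 * n) := by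
        rw [Finset.card_univ, Fintype.card_fun, Fintype.card_fin, Fintype.card_fin, ← pow_mul, mul_comm]

/-- **Expanding the square and counting.** For every `f`,
`Σ_{x,x'} count_n(x,x') f(x) f(x') = Σ_z (Σ_{y ∈ Q_n} f(z + ι y))²`: expand the square as a sum over pairs
`(y, y')`, substitute `x = z + ι y` (a bijection of the torus), and write `count_n` as a sum of indicators. -/
theorem ker_sum_card_mul_eq {L : ℕ} [NeZero L] (n : ℕ) (f : TorusSite 3 L → ℝ) :
    ∑ x : TorusSite 3 L, ∑ x' : TorusSite 3 L,
      (((Finset.univ.filter (fun p : (Fin 3 → Fin (2 ^ n)) × (Fin 3 → Fin (2 ^ n)) =>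
        x' + (fun k => ((p.1 k : ℕ) : ZMod L)) = x + (fun k => ((p.2 k : ℕ) : ZMod L)))).card : ℕ) : ℝ) *
          (f x * f x') =
    ∑ z : TorusSite 3 L, (∑ y : Fin 3 → Fin (2 ^ n), f (z + (fun k => ((y k : ℕ) : ZMod L)))) ^ 2 := by
  have hR : ∀ z : TorusSite 3 L, (∑ y : Fin 3 → Fin (2 ^ n), f (z + (fun k => ((y k : ℕ) : ZMod L)))) ^ 2 =
      ∑ p : (Fin 3 → Fin (2 ^ n)) × (Fin 3 → Fin (2 ^ n)),
        f (z + fun k => ((p.1 k : ℕ) : ZMod L)) * f (z + fun k => ((p.2 k : ℕ) : ZMod L)) := by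
    intro z
    rw [sq, Finset.sum_mul_sum, Fintype.sum_prod_type]
  have hL : ∀ x x' : TorusSite 3 L,
      (((Finset.univ.filter (fun p : (Fin 3 → Fin (2 ^ n)) × (Fin 3 → Fin (2 ^ n)) =>
        x' + (fun k => ((p.1 k : ℕ) : ZMod L)) = x + (fun k => ((p.2 k : ℕ) : ZMod L)))).card : ℕ) : ℝ) *
          (f x * f x') =
      ∑ p : (Fin 3 → Fin (2 ^ n)) × (Fin 3 → Fin (2 ^ n)),
        if x' + (fun k => ((p.1 k : ℕ) : ZMod L)) = x + (fun k => ((p.2 k : ℕ) : ZMod L)) then f x * f x' else 0 := by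
    intro x x'
    rw [Finset.natCast_card_filter, Finset.sum_mul]
    simp_rw [ite_mul, one_mul, zero_mul]
  simp_rw [hL, hR]
  calc ∑ x : TorusSite 3 L, ∑ x' : TorusSite 3 L, ∑ p : (Fin 3 → Fin (2 ^ n)) × (Fin 3 → Fin (2 ^ n)),
          (if x' + (fun k => ((p.1 k : ℕ) : ZMod L)) = x + (fun k => ((p.2 k : ℕ) : ZMod L)) then f x * f x' else 0)
      = ∑ x : TorusSite 3 L, ∑ p : (Fin 3 → Fin (2 ^ n)) × (Fin 3 → Fin (2 ^ n)),
          f x * f (x + (fun k => ((p.2 k : ℕ) : ZMod L)) - (fun k => ((p.1 k : ℕ) : ZMod L))) := by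
        refine Finset.sum_congr rfl fun x _ => ?_
        rw [Finset.sum_comm]
        refine Finset.sum_congr rfl fun p _ => ?_
        rw [Finset.sum_eq_single_of_mem
          (x + (fun k => ((p.2 k : ℕ) : ZMod L)) - (fun k => ((p.1 k : ℕ) : ZMod L))) (Finset.mem_univ _)]
        · rw [if_pos (sub_add_cancel _ _)]
        · intro x' _ hx'
          rw [if_neg]
          intro h
          exact hx' (eq_sub_of_add_eq h)
    _ = ∑ p : (Fin 3 → Fin (2 ^ n)) × (Fin 3 → Fin (2 ^ n)), ∑ x : TorusSite 3 L,
          f x * f (x + (fun k => ((p.2 k : ℕ) : ZMod L)) - (fun k => ((p.1 k : ℕ) : ZMod L))) :=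
        Finset.sum_comm
    _ = ∑ p : (Fin 3 → Fin (2 ^ n)) × (Fin 3 → Fin (2 ^ n)), ∑ z : TorusSite 3 L,
          f (z + fun k => ((p.1 k : ℕ) : ZMod L)) * f (z + fun k => ((p.2 k : ℕ) : ZMod L)) := by
        refine Finset.sum_congr rfl fun p _ => ?_
        refine (Fintype.sum_equiv (Equiv.addRight fun k => ((p.1 k : ℕ) : ZMod L)) _ _ fun z => ?_).symm
        rw [Equiv.coe_addRight, add_right_comm, add_sub_cancel_right]
    _ = ∑ z : TorusSite 3 L, ∑ p : (Fin 3 → Fin (2 ^ n)) × (Fin 3 → Fin (2 ^ n)),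
          f (z + fun k => ((p.1 k : ℕ) : ZMod L)) * f (z + fun k => ((p.2 k : ℕ) : ZMod L)) :=
        Finset.sum_comm

/-! ### The three properties of the block kernel -/

/-- **Non-negativity** of `κ(x,x') = ε c Σ_{n<N} count_n(x,x')/2^(6n)` for `ε, c ≥ 0`. -/
theorem ker_nonneg {L : ℕ} (N : ℕ) (ε c : ℝ) (hε : 0 ≤ ε) (hc : 0 ≤ c) (x x' : TorusSite 3 L) :
    0 ≤ ε * c * ∑ n ∈ Finset.range N, (((Finset.univ.filter (fun p : (Fin 3 → Fin (2 ^ n)) × (Fin 3 → Fin (2 ^ n)) =>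
      x' + (fun k => ((p.1 k : ℕ) : ZMod L)) = x + (fun k => ((p.2 k : ℕ) : ZMod L)))).card : ℕ) : ℝ) /
        (2 : ℝ) ^ (6 * n) :=
  mul_nonneg (mul_nonneg hε hc) (Finset.sum_nonneg fun _ _ => by positivity)

/-- **The dyadic tail.** For `2^N ≤ L`: `Σ_{n<N} count_n(x,x')/2^(6n) ≤ (1728/7)/(dist(x,x') + 6)³`. Each term is
`≤ 8^(-n)` (`ker_card_le`) and vanishes unless `dist + 6 ≤ 6·2ⁿ` (`ker_dist_le_of_card_ne_zero`); with `n₀` the least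
such `n < N`, the sum is `≤ Σ_{n₀ ≤ n < N} 8^(-n) ≤ (8/7) 8^(-n₀) ≤ (8/7)·216/(dist + 6)³`. -/
theorem ker_sum_le {L : ℕ} [NeZero L] (N : ℕ) (hNL : 2 ^ N ≤ L) (x x' : TorusSite 3 L) :
    ∑ n ∈ Finset.range N, (((Finset.univ.filter (fun p : (Fin 3 → Fin (2 ^ n)) × (Fin 3 → Fin (2 ^ n)) =>
      x' + (fun k => ((p.1 k : ℕ) : ZMod L)) = x + (fun k => ((p.2 k : ℕ) : ZMod L)))).card : ℕ) : ℝ) /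
        (2 : ℝ) ^ (6 * n) ≤
      1728 / 7 / (((torusGraph 3 L).dist x x' : ℝ) + 6) ^ 3 := by
  set d : ℕ := (torusGraph 3 L).dist x x'
  have hterm : ∀ n ∈ Finset.range N,
      (((Finset.univ.filter (fun p : (Fin 3 → Fin (2 ^ n)) × (Fin 3 → Fin (2 ^ n)) =>
        x' + (fun k => ((p.1 k : ℕ) : ZMod L)) = x + (fun k => ((p.2 k : ℕ) : ZMod L)))).card : ℕ) : ℝ) /
          (2 : ℝ) ^ (6 * n) ≤
        if d + 6 ≤ 6 * 2 ^ n then (1 / 8 : ℝ) ^ n else 0 := by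
    intro n hn
    have h2n : 2 ^ n ≤ L :=
      le_trans (Nat.pow_le_pow_right (by norm_num) (Finset.mem_range.1 hn).le) hNL
    split_ifs with hP
    · rw [div_le_iff₀ (by positivity)]
      calc (((Finset.univ.filter (fun p : (Fin 3 → Fin (2 ^ n)) × (Fin 3 → Fin (2 ^ n)) =>
              x' + (fun k => ((p.1 k : ℕ) : ZMod L)) = x + (fun k => ((p.2 k : ℕ) : ZMod L)))).card : ℕ) : ℝ)
          ≤ (2 : ℝ) ^ (3 * n) := by exact_mod_cast ker_card_le n h2n x x'
        _ = (1 / 8 : ℝ) ^ n * (2 : ℝ) ^ (6 * n) := by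
          rw [pow_mul, pow_mul, ← mul_pow]
          norm_num
    · have h0 : (Finset.univ.filter (fun p : (Fin 3 → Fin (2 ^ n)) × (Fin 3 → Fin (2 ^ n)) =>
          x' + (fun k => ((p.1 k : ℕ) : ZMod L)) = x + (fun k => ((p.2 k : ℕ) : ZMod L)))).card = 0 := by
        by_contra hne
        exact hP (ker_dist_le_of_card_ne_zero n x x' hne)
      simp [h0]
  refine (Finset.sum_le_sum hterm).trans ?_
  rw [← Finset.sum_filter]
  set S := (Finset.range N).filter (fun n => d + 6 ≤ 6 * 2 ^ n)
  rcases S.eq_empty_or_nonempty with hSe | hSne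
  · rw [hSe, Finset.sum_empty]
    positivity
  · obtain ⟨n₀, hn₀S, hmin⟩ : ∃ n₀ ∈ S, ∀ n ∈ S, n₀ ≤ n :=
      ⟨S.min' hSne, S.min'_mem hSne, fun n hn => S.min'_le n hn⟩
    have hP₀ : d + 6 ≤ 6 * 2 ^ n₀ := (Finset.mem_filter.1 hn₀S).2
    have hsub : S ⊆ Finset.Ico n₀ N := by
      intro n hn
      rw [Finset.mem_Ico]
      exact ⟨hmin n hn, Finset.mem_range.1 (Finset.mem_filter.1 hn).1⟩
    have hkey : (1 / 8 : ℝ) ^ n₀ ≤ 216 / ((d : ℝ) + 6) ^ 3 := by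
      have hP₀' : (d : ℝ) + 6 ≤ 6 * 2 ^ n₀ := by exact_mod_cast hP₀
      rw [div_pow, one_pow, div_le_div_iff₀ (by positivity) (by positivity), one_mul]
      calc ((d : ℝ) + 6) ^ 3 ≤ (6 * 2 ^ n₀) ^ 3 := pow_le_pow_left₀ (by positivity) hP₀' 3
        _ = 216 * 8 ^ n₀ := by
          rw [mul_pow, ← pow_mul, mul_comm n₀ 3, pow_mul]
          norm_num
    calc ∑ n ∈ S, (1 / 8 : ℝ) ^ n ≤ ∑ n ∈ Finset.Ico n₀ N, (1 / 8 : ℝ) ^ n :=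
          Finset.sum_le_sum_of_subset_of_nonneg hsub fun n _ _ => by positivity
      _ ≤ (1 / 8 : ℝ) ^ n₀ / (1 - 1 / 8) := geom_sum_Ico_le_of_lt_one (by norm_num) (by norm_num)
      _ = 8 / 7 * (1 / 8 : ℝ) ^ n₀ := by ring
      _ ≤ 8 / 7 * (216 / ((d : ℝ) + 6) ^ 3) := mul_le_mul_of_nonneg_left hkey (by norm_num)
      _ = 1728 / 7 / ((d : ℝ) + 6) ^ 3 := by ring

/-- **Admissibility with exponent three.** For `2^N ≤ L`, `ε, c ≥ 0`, `c ≤ 1/512`: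
`κ(x,x') ≤ ε/(1 + dist(x,x'))³` (from `ker_sum_le` and `(1728/7)·c/(d+6)³ ≤ 1/(1+d)³`, which needs only
`c ≤ 7/1728`). -/
theorem ker_kernel_le {L : ℕ} [NeZero L] (N : ℕ) (hNL : 2 ^ N ≤ L) (ε c : ℝ) (hε : 0 ≤ ε) (hc : 0 ≤ c)
    (hc' : c ≤ 1 / 512) (x x' : TorusSite 3 L) :
    ε * c * ∑ n ∈ Finset.range N, (((Finset.univ.filter (fun p : (Fin 3 → Fin (2 ^ n)) × (Fin 3 → Fin (2 ^ n)) =>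
      x' + (fun k => ((p.1 k : ℕ) : ZMod L)) = x + (fun k => ((p.2 k : ℕ) : ZMod L)))).card : ℕ) : ℝ) /
        (2 : ℝ) ^ (6 * n) ≤
      ε / (1 + ((torusGraph 3 L).dist x x' : ℝ)) ^ 3 := by
  have hd0 : (0 : ℝ) ≤ ((torusGraph 3 L).dist x x' : ℝ) := Nat.cast_nonneg _
  calc ε * c * ∑ n ∈ Finset.range N, (((Finset.univ.filter (fun p : (Fin 3 → Fin (2 ^ n)) × (Fin 3 → Fin (2 ^ n)) =>
          x' + (fun k => ((p.1 k : ℕ) : ZMod L)) = x + (fun k => ((p.2 k : ℕ) : ZMod L)))).card : ℕ) : ℝ) /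
            (2 : ℝ) ^ (6 * n)
      ≤ ε * c * (1728 / 7 / (((torusGraph 3 L).dist x x' : ℝ) + 6) ^ 3) :=
        mul_le_mul_of_nonneg_left (ker_sum_le N hNL x x') (mul_nonneg hε hc)
    _ ≤ ε * ((1 / 512) * (1728 / 7 / (1 + ((torusGraph 3 L).dist x x' : ℝ)) ^ 3)) := by
        rw [mul_assoc]
        refine mul_le_mul_of_nonneg_left ?_ hε
        refine mul_le_mul hc' ?_ (by positivity) (by norm_num)
        refine div_le_div_of_nonneg_left (by norm_num) (by positivity) ?_
        exact pow_le_pow_left₀ (by positivity) (by linarith) 3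
    _ ≤ ε * (1 / (1 + ((torusGraph 3 L).dist x x' : ℝ)) ^ 3) := by
        refine mul_le_mul_of_nonneg_left ?_ hε
        rw [show (1 / 512 : ℝ) * (1728 / 7 / (1 + ((torusGraph 3 L).dist x x' : ℝ)) ^ 3) =
          (1728 / 3584) * (1 / (1 + ((torusGraph 3 L).dist x x' : ℝ)) ^ 3) by ring]
        exact mul_le_of_le_one_left (by positivity) (by norm_num)
    _ = ε / (1 + ((torusGraph 3 L).dist x x' : ℝ)) ^ 3 := by rw [← div_eq_mul_one_div]

/-- **The perturbation of a site kernel.** If `K(b,b') = κ(x,x')` depends only on the sites `x = b.1`, `x' = b'.1`,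
then `W_K(θ) = Σ_{x,x'} κ(x,x') j_θ(x) j_θ(x')` with the site current `j_θ(x) = Σ_i cur (x,i) θ`. -/
theorem ker_Wk_site {L : ℕ} [NeZero L] (κ : TorusSite 3 L → TorusSite 3 L → ℝ) (θ : TorusSite 3 L → ℝ) :
    Wk (fun b b' : Bond L => ((κ b.1 b'.1 : ℝ) : ℂ)) θ =
      ((∑ x : TorusSite 3 L, ∑ x' : TorusSite 3 L,
        κ x x' * ((∑ i : Fin 3, cur (x, i) θ) * (∑ i : Fin 3, cur (x', i) θ)) : ℝ) : ℂ) := by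
  simp only [Wk, Fintype.sum_prod_type]
  push_cast
  refine Finset.sum_congr rfl fun x _ => ?_
  rw [Finset.sum_comm]
  refine Finset.sum_congr rfl fun x' _ => ?_
  rw [Finset.sum_mul_sum, Finset.mul_sum]
  refine Finset.sum_congr rfl fun i _ => ?_
  rw [Finset.mul_sum]
  refine Finset.sum_congr rfl fun i' _ => ?_
  ring

/-- **The W identity for the block kernel, real form.** For every `g`,
`Σ_{x,x'} κ(x,x') g(x) g(x') = ε c Σ_{n<N} Σ_z ((Σ_{y ∈ Q_n} g(z + ι y))/2^(3n))²` (linearity and `ker_sum_card_mul_eq`). -/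
theorem ker_sum_kernel_mul_eq {L : ℕ} [NeZero L] (N : ℕ) (ε c : ℝ) (g : TorusSite 3 L → ℝ) :
    ∑ x : TorusSite 3 L, ∑ x' : TorusSite 3 L,
      (ε * c * ∑ n ∈ Finset.range N, (((Finset.univ.filter (fun p : (Fin 3 → Fin (2 ^ n)) × (Fin 3 → Fin (2 ^ n)) =>
        x' + (fun k => ((p.1 k : ℕ) : ZMod L)) = x + (fun k => ((p.2 k : ℕ) : ZMod L)))).card : ℕ) : ℝ) /
          (2 : ℝ) ^ (6 * n)) * (g x * g x') =
    ε * c * ∑ n ∈ Finset.range N, ∑ z : TorusSite 3 L,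
      ((∑ y : Fin 3 → Fin (2 ^ n), g (z + (fun k => ((y k : ℕ) : ZMod L)))) / (2 : ℝ) ^ (3 * n)) ^ 2 := by
  have key : ∀ n : ℕ, ∑ z : TorusSite 3 L,
      ((∑ y : Fin 3 → Fin (2 ^ n), g (z + (fun k => ((y k : ℕ) : ZMod L)))) / (2 : ℝ) ^ (3 * n)) ^ 2 =
      (∑ x : TorusSite 3 L, ∑ x' : TorusSite 3 L,
        (((Finset.univ.filter (fun p : (Fin 3 → Fin (2 ^ n)) × (Fin 3 → Fin (2 ^ n)) =>
          x' + (fun k => ((p.1 k : ℕ) : ZMod L)) = x + (fun k => ((p.2 k : ℕ) : ZMod L)))).card : ℕ) : ℝ) *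
            (g x * g x')) / (2 : ℝ) ^ (6 * n) := by
    intro n
    rw [ker_sum_card_mul_eq n g, Finset.sum_div]
    refine Finset.sum_congr rfl fun z _ => ?_
    rw [div_pow, ← pow_mul, show 3 * n * 2 = 6 * n by ring]
  simp_rw [key, Finset.sum_div, Finset.mul_sum, Finset.sum_mul]
  symm
  rw [Finset.sum_comm]
  refine Finset.sum_congr rfl fun x _ => ?_
  rw [Finset.sum_comm]
  refine Finset.sum_congr rfl fun x' _ => Finset.sum_congr rfl fun n _ => ?_
  ring

/-- **Stub `stub_e3Kernel` (c5 tightness): the block kernel.** For `2^N ≤ L`, `0 ≤ ε`, `0 ≤ c ≤ 1/512`, the real kernel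
`κ(x,x') = εc Σ_{n<N} #{(y,y') : x' + ι y = x + ι y'}/2^(6n)` (direction-blind on bonds) is admissible with exponent THREE
(`#{…} ≤ 2^(3n)` by injectivity of `ι` on `Q_n` for `2ⁿ ≤ L`, and `#{…} = 0` unless `dist(x,x') + 6 ≤ 6·2ⁿ` — a walk of unit
steps; then `Σ_{n : 6·2ⁿ ≥ d+6} 2^(-3n) ≤ (8/7)·216/(d+6)³` against `c ≤ 1/512 ≤ 7/1728`), non-negative, and its
perturbation is EXACTLY `W = εc Σ_{n<N} S_n` (expand the squares and count). -/
theorem stub_e3Kernel (L N : ℕ) [NeZero L] (hNL : 2 ^ N ≤ L) (ε c : ℝ) (hε : 0 ≤ ε) (hc : 0 ≤ c)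
    (hc' : c ≤ 1 / 512) :
    (∀ b b' : Bond L,
        ‖(((ε * c * ∑ n ∈ Finset.range N, (((Finset.univ.filter (fun p : (Fin 3 → Fin (2 ^ n)) × (Fin 3 → Fin (2 ^ n)) => b'.1 + (fun k => ((p.1 k : ℕ) : ZMod L)) = b.1 + (fun k => ((p.2 k : ℕ) : ZMod L)))).card : ℕ) : ℝ) / (2 : ℝ) ^ (6 * n)) : ℝ) : ℂ)‖ ≤
          ε / (1 + ((torusGraph 3 L).dist b.1 b'.1 : ℝ)) ^ 3) ∧
    (∀ θ : TorusSite 3 L → ℝ,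
        Wk (fun b b' : Bond L => (((ε * c * ∑ n ∈ Finset.range N, (((Finset.univ.filter (fun p : (Fin 3 → Fin (2 ^ n)) × (Fin 3 → Fin (2 ^ n)) => b'.1 + (fun k => ((p.1 k : ℕ) : ZMod L)) = b.1 + (fun k => ((p.2 k : ℕ) : ZMod L)))).card : ℕ) : ℝ) / (2 : ℝ) ^ (6 * n)) : ℝ) : ℂ)) θ =
          ((ε * c * ∑ n ∈ Finset.range N, (∑ z : TorusSite 3 L, ((∑ y : Fin 3 → Fin (2 ^ n), ∑ i : Fin 3, cur (z + (fun k => ((y k : ℕ) : ZMod L)), i) θ) / (2 : ℝ) ^ (3 * n)) ^ 2) : ℝ) : ℂ)) ∧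
    (∀ x x' : TorusSite 3 L, 0 ≤ (ε * c * ∑ n ∈ Finset.range N, (((Finset.univ.filter (fun p : (Fin 3 → Fin (2 ^ n)) × (Fin 3 → Fin (2 ^ n)) => x' + (fun k => ((p.1 k : ℕ) : ZMod L)) = x + (fun k => ((p.2 k : ℕ) : ZMod L)))).card : ℕ) : ℝ) / (2 : ℝ) ^ (6 * n))) := by
  refine ⟨fun b b' => ?_, fun θ => ?_, fun x x' => ker_nonneg N ε c hε hc x x'⟩
  · rw [Complex.norm_real, Real.norm_of_nonneg (ker_nonneg N ε c hε hc b.1 b'.1)]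
    exact ker_kernel_le N hNL ε c hε hc hc' b.1 b'.1
  · refine (ker_Wk_site (fun x x' : TorusSite 3 L => ε * c * ∑ n ∈ Finset.range N,
      (((Finset.univ.filter (fun p : (Fin 3 → Fin (2 ^ n)) × (Fin 3 → Fin (2 ^ n)) =>
        x' + (fun k => ((p.1 k : ℕ) : ZMod L)) = x + (fun k => ((p.2 k : ℕ) : ZMod L)))).card : ℕ) : ℝ) /
          (2 : ℝ) ^ (6 * n)) θ).trans ?_
    exact congr_arg _ (ker_sum_kernel_mul_eq N ε c (fun z => ∑ i : Fin 3, cur (z, i) θ))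

end Summit.HubbardSuperconductivity.HubbardSuperconductivity.Theorems.PerturbedXYOrder

end
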